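import Summits.Langlands.Langlands.Theses.IrreducibilityBySelfDuality
import Summits.Langlands.Langlands.Theorems.IrreducibilityBySelfDualityIrreducibleOffSectorNoAbelianAvatar
import Summits.Langlands.Langlands.Theorems.IrreducibilityBySelfDualityWeakAbelianSummandHecke
import HarnessLib

/-!
# No abelian / triangularisable avatars on the regular locus, on the route's decls
(crux stmt-Langlands-14329 `IrreducibilityBySelfDuality.IrreducibleOffSector`, line `Sketch`;
`--supports` file naming the route decls — it imports the Theses file and is therefore NOT for use
inside `closes`; the structural forms are in `…IrreducibleOffSectorNoAbelianAvatar`; continuation lead c8)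

GIVEN only the route's two open INPUT items `PairLBoundaryJS` (stmt-Langlands-13622, Arthur–Clozel
(2.2)) and `HeckeEigenvalueField` (stmt-Langlands-13632, Clozel 1990 Thm. 3.13) — the Böckle–Hui input
`WeakAbelianSummandHecke` (stmt-Langlands-13620) is a THEOREM of the tree (`WeakAbelianSummandHecke_proof`)
and is fed here, and Arthur–Clozel (2.3) enters in rank one only, where it is Hecke's theorem — the
following shadow of the crux holds in EVERY rank `n ≥ 2` over EVERY number field `K`: for every cuspidal
`π` on `GL_n(𝔸_K)` that is L-algebraic with a regular infinity type and every `ρ : Γ_K → GL_n(ℚ̄_ℓ)`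
Satake–Frobenius compatible with `(π, ι)` at almost all places,

* `irreducibleOffSector_no_abelian_avatar_of_isRegular` — `det(X - ρ)` is not a product of `n`
  continuous characters (the semisimplification of `ρ` is not a sum of characters);
* `irreducibleOffSector_no_triangular_avatar_of_isRegular` — no conjugate `P ρ P⁻¹` is upper
  triangular;
* `irreducibleOffSector_text_no_triangular_avatar_of_isRegular` — the same in the crux's binder shape.

So, wherever compatible `ρ` exist (totally real / CM `K`: lang.S27; conjecturally everywhere), a
reducible one has an irreducible constituent of dimension `≥ 2` which is not weakly automorphic
(`exists_block_not_weaklyAutomorphic_of_rational`): the crux on the regular locus is reduced to ruling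
out such constituents.

References: G. Böckle, C.-Y. Hui, Math. Ann. 393 (2025), Thm. 1.1, §3.2.1; L. Clozel (1990), Thm. 3.13;
K. Ribet, LNM 601 (1977), Thm. 2.3; H. Jacquet, J. Shalika, Amer. J. Math. 103 (1981) II, Thm. 4.4.
-/

noncomputable section

set_option linter.dupNamespace false

open scoped NumberField
open Filter IsDedekindDomain
open Literature.NumberTheory.Automorphic Literature.NumberTheory.GaloisRepresentations
open Summit.Langlands
open Summit.Langlands.Langlands.Theses.IrreducibilityBySelfDuality

namespace Summit.Langlands.Langlands.Theorems.IrreducibleOffSector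

/-- **No abelian avatars on the regular locus, from the route inputs `PairLBoundaryJS` and
`HeckeEigenvalueField`** (every rank `n ≥ 2`, every number field): for `π` cuspidal on `GL_n(𝔸_K)`,
L-algebraic with a regular infinity type, every `ρ` Satake–Frobenius compatible with `(π, ι)` at almost
all places and every family of continuous characters `χ_i : Γ_K → GL_1(ℚ̄_ℓ)`, `det(X - ρ σ) ≠ ∏ᵢ
det(X - χ_i σ)` for some `σ` (`not_charpoly_eq_prod_rank_one_of_isRegular` fed with the proved item
`WeakAbelianSummandHecke_proof`). [cite: BockleHui2025, Theorem 1.1 and §3.2.1] [cite: Clozel1990, Thm. 3.13] -/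
theorem irreducibleOffSector_no_abelian_avatar_of_isRegular (i4 : PairLBoundaryJS)
    (i6 : HeckeEigenvalueField) {K : Type} [Field K] [NumberField K] {n : ℕ} (hn : 2 ≤ n)
    {hcpt : isCompact_glFiniteIntegralLevel n K} (π : CuspidalAutomorphicRepData n K hcpt)
    (hL : π.1.IsLAlgebraic) (hreg : ∃ T : InfinityType K n, π.1.HasInfinityType T ∧ T.IsRegular)
    {ℓ : ℕ} [Fact ℓ.Prime] (ι : PadicAlgCl ℓ ≃+* ℂ) (ρ : FramedGaloisRep K (PadicAlgCl ℓ) n)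
    (hρ : ∀ᶠ v : HeightOneSpectrum (𝓞 K) in cofinite, SatakeFrobCompatibleAt ι π.1 ρ v)
    (χ : Fin n → FramedGaloisRep K (PadicAlgCl ℓ) 1) :
    ¬ ∀ σ, ρ.charpoly σ = ∏ i, (χ i).charpoly σ :=
  not_charpoly_eq_prod_rank_one_of_isRegular
    Summit.Langlands.Langlands.Theorems.WeakAbelianSummandHecke_proof i6 i4 hn π hL hreg ι ρ hρ χ

/-- **No triangularisable avatars on the regular locus, from the route inputs `PairLBoundaryJS` and
`HeckeEigenvalueField`** (every rank `n ≥ 2`, every number field): with `π`, `ρ` as above, no conjugate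
`P ρ P⁻¹`, `P ∈ GL_n(ℚ̄_ℓ)`, is upper triangular. [cite: BockleHui2025, Theorem 1.1 and §3.2.1] [cite: Clozel1990, Thm. 3.13] -/
theorem irreducibleOffSector_no_triangular_avatar_of_isRegular (i4 : PairLBoundaryJS)
    (i6 : HeckeEigenvalueField) {K : Type} [Field K] [NumberField K] {n : ℕ} (hn : 2 ≤ n)
    {hcpt : isCompact_glFiniteIntegralLevel n K} (π : CuspidalAutomorphicRepData n K hcpt)
    (hL : π.1.IsLAlgebraic) (hreg : ∃ T : InfinityType K n, π.1.HasInfinityType T ∧ T.IsRegular)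
    {ℓ : ℕ} [Fact ℓ.Prime] (ι : PadicAlgCl ℓ ≃+* ℂ) (ρ : FramedGaloisRep K (PadicAlgCl ℓ) n)
    (hρ : ∀ᶠ v : HeightOneSpectrum (𝓞 K) in cofinite, SatakeFrobCompatibleAt ι π.1 ρ v)
    (P : GL (Fin n) (PadicAlgCl ℓ)) : ¬ (ρ.conj P).IsUpperTriangular :=
  not_isUpperTriangular_conj_of_isRegular
    Summit.Langlands.Langlands.Theorems.WeakAbelianSummandHecke_proof i6 i4 hn π hL hreg ι ρ hρ P

/-- **The proved shadow of the crux on the regular locus, in the crux's own binder shape**, from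
`PairLBoundaryJS` and `HeckeEigenvalueField`: the text of `IrreducibleOffSector` with `0 < n`
strengthened to `2 ≤ n`, the regularity of an infinity type of `π` added, the (domain-shrinking) sector
clause dropped, and the conclusion `ρ.toGaloisRep.IsIrreducible` replaced by its consequence "no
upper triangular conjugate". [cite: BockleHui2025, Theorem 1.1 and §3.2.1] [cite: Clozel1990, Thm. 3.13] -/
theorem irreducibleOffSector_text_no_triangular_avatar_of_isRegular (i4 : PairLBoundaryJS)
    (i6 : HeckeEigenvalueField) :
    ∀ (n : ℕ) (K : Type) [Field K] [NumberField K]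
      (hcpt : Literature.NumberTheory.Automorphic.isCompact_glFiniteIntegralLevel n K), 2 ≤ n →
      ∀ (π : Literature.NumberTheory.Automorphic.CuspidalAutomorphicRepData n K hcpt), π.1.IsLAlgebraic →
        (∃ T : Literature.NumberTheory.Automorphic.InfinityType K n, π.1.HasInfinityType T ∧ T.IsRegular) →
        ∀ (ℓ : ℕ) [Fact ℓ.Prime] (ι : PadicAlgCl ℓ ≃+* ℂ)
          (ρ : Literature.NumberTheory.GaloisRepresentations.FramedGaloisRep K (PadicAlgCl ℓ) n),
          (∀ᶠ v : IsDedekindDomain.HeightOneSpectrum (NumberField.RingOfIntegers K) in cofinite,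
            SatakeFrobCompatibleAt ι π.1 ρ v) →
            ∀ P : GL (Fin n) (PadicAlgCl ℓ), ¬ (ρ.conj P).IsUpperTriangular :=
  no_triangular_avatar_text_of_isRegular
    Summit.Langlands.Langlands.Theorems.WeakAbelianSummandHecke_proof i6 i4

end Summit.Langlands.Langlands.Theorems.IrreducibleOffSector

end
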